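import Summits.Langlands.Langlands.Theses.DyadicOddResidue
import Literature.NumberTheory.Automorphic.IsAutomorphicAE
import Literature.NumberTheory.GaloisRepresentations.ProjectiveTypeSolvable
import Literature.NumberTheory.GaloisRepresentations.AbsIrreducibleIndexTwo
import Literature.NumberTheory.NumberFields.ConjugationSolvable

/-!
# Disproof of `DyadicNonsolvableFM` (stmt-Langlands-18744) — findings

Standing crux-disprover work file (cdisprove, route `DyadicOddResidue`, opened 2026-08-17,
refuter-cdisprove-stmt-Langlands-18744-0, cycle 1).  Prose lives in docstrings only.

## Verdict of cycle 1: NO KILL — the crux is a typed rendering of a PRINTED THEOREM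

`DyadicNonsolvableFM` = Fontaine–Mazur modularity over `ℚ` at `ℓ = 2` for `ρ : Γ_ℚ → GL₂(ℚ̄₂)`
continuous, residually absolutely irreducible with NON-solvable residual image, irreducible,
odd, unramified a.e., de Rham at `2` (Fontaine's pinned datum) with distinct labelled
Hodge–Tate weights ⟹ `∀ hcpt ι, IsAutomorphicAE ι hcpt ρ` (an L-algebraic cuspidal `π` of
`GL₂(𝔸_ℚ)`, Satake–Frobenius compatible a.e., Buzzard–Gee L-normalisation `m = 1`).
In print: S.-N. Tung, *On the modularity of 2-adic potentially semi-stable deformation rings*,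
Math. Z. 298 (2021) = arXiv:1908.06174, **Theorem 1** (p. 4 of the held text: "Assume `p = 2`.
Let `ρ` be as in the conjecture [continuous, irreducible, odd, unramified a.e., de Rham with
distinct HT weights] … `ρ̄` is modular … `ρ̄` has non-solvable image. Then `ρ` is modular") and
**Theorem 8.0.4** (p. 32, totally real `F`, `2` totally split, "(up to twist) `ρ` comes from a
Hilbert modular form"); residual modularity = Khare–Wintenberger 2009 Thm. 1.2 (all `p`,
including `2`; oddness is vacuous mod `2`) + Kisin 2009 (2-adic); "modular up to twist" ⟹
`IsAutomorphicAE` by the newform → L-algebraic-`π` dictionary (`π = π_f^∨ ⊗ |det|^{(k-1)/2} ⊗ χ`,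
the twist `χ = ρ ⊗ ρ_f^{-1}` being de Rham, i.e. `ε^m ·` finite order).  The typed clauses are
VERBATIM those of the accepted named fact `Tung2021_fontaineMazurGL2`
(`Literature/NumberTheory/Automorphic/FontaineMazurGL2OddPrime`, `p ≠ 2`), with the residual
hypothesis replaced and the conclusion in the automorphic (not newform) rendering — the same
rendering as the accepted `HuTan2015_theorem63` consumers.  A `¬`-theorem of the crux would
refute a published theorem; none is expected, none was found.

## What a Lean refutation would need, and why none is available (resists because …)

`¬ DyadicNonsolvableFM` needs a WITNESS `ρ : FramedGaloisRep ℚ (PadicAlgCl 2) 2` with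
non-solvable residual image (smallest possible image `SL₂(𝔽₄) ≅ A₅`: every subgroup of
`GL₂(𝔽₂) ≅ S₃` is solvable, so `ρ̄` is never definable over `𝔽₂` — in particular NO elliptic
curve over `ℚ` and no rep with `𝔽₂`-rational traces mod `2` is an instance of this crux; those
live in the sibling cruxes `DyadicEisensteinFM` / `DyadicDihedralFM`) together with a proof that
no cuspidal `π` matches it.  The tree constructs no `2`-adic Galois representation of `Γ_ℚ` with
non-solvable reduction (Tate modules / `ρ_f` exist only as the named fact
`exists_padicGaloisRep_of_isNewform1`), and every such `ρ` in nature IS modular.  Interface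
attacks (junk `residualRep = 1` has solvable range and is excluded by `hsol`; `HasSatakeParamAt`
/ `CuspidalAutomorphicRepData` junk would make the crux trivially TRUE, not false; the
L-normalisation `arithFrobPolyOfSatake ι q 1 α` is consistent with `ρ_f ↔ π_f^∨ ⊗ |det|^{(k-1)/2}`)
give nothing.

## Contents (all theorems `sorry`-free unless marked NEAR-MISS)

* §0 Generic lemmas (rank 2, any field): `hasCommonEigenvector_of_not_isIrreducible`,
  `isSolvable_eigenvectorStabilizer(_single)` (Borel of `GL₂` is solvable),
  `isSolvable_range_of_not_isIrreducible`, `isAbsIrreducible_of_not_isSolvable_range`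
  (**non-solvable image ⟹ absolutely irreducible**), `isSolvable_range_of_ker_le`,
  `isResiduallyAbsIrreducible_of_not_isSolvable_residualRep_range` (**`hsol ⟹ hres`**),
  `isIrreducible_of_isResiduallyAbsIrreducible` (**`hres ⟹ hirr`**, from the tree's Burnside
  form, DDT §2.1), `isIrreducible_of_not_isSolvable_residualRep_range` (**`hsol ⟹ hirr`**).
* §1 `DyadicNonsolvableFMAtTwo`, `dyadicNonsolvableFM_iff_atTwo`: the `∀ ℓ, ℓ = 2 →` binder is
  cosmetic; clause abbreviations `AEUnramified`, `DeRhamRegularAtTwo`, `AutomorphicAE`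
  (`automorphicAE_iff`: the conclusion IS `IsAutomorphicAE`).
* §2 HYPOTHESIS MUTATION, proved: `DyadicNonsolvableFMMinimal` (five hypotheses: `hsol`, `hodd`,
  a.e. unramified, de Rham regular) and `dyadicNonsolvableFM_iff_minimal` — the hypotheses
  `ρ.IsResiduallyAbsIrreducible` and `ρ.toGaloisRep.IsIrreducible` are DECORATION (implied by
  `¬ IsSolvable ρ.residualRep.range`).  Provers may `intro` and discard them; planners may drop
  them from the signature without changing its strength.
* §3 LOAD-BEARING ANALYSIS of the remaining hypotheses, as `def …Without<H> : Prop` with status: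
  - `hsol` (non-solvable residual image): `withoutNonsolvable_iff` — dropping it is EXACTLY the
    conjunction `DyadicEisensteinFM ∧ DyadicDihedralFM ∧ DyadicNonsolvableFM` of the route (the
    trichotomy of `closes`), i.e. the two OPEN cruxes; load-bearing modulo open problems, never
    refutable short of a counterexample to Fontaine–Mazur.
  - `hodd`: `DyadicNonsolvableFMWithoutOdd` — OPEN and conjecturally TRUE for want of instances
    (an even irreducible geometric `ρ` with distinct HT weights would come, by FM + Langlands,
    from a regular L-algebraic cuspidal `π` of `GL₂/ℚ`, whose `π_∞` is discrete series, so
    `ρ` would be odd; unconditional non-existence is Calegari 2011/2012 only for `p > 7`).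
    Not refutable; genuinely used by Tung's proof (central character of the definite
    quaternionic forms = `ε⁻¹ det ρ` must be a Hecke character of the right parity).
  - de Rham at `2`: `DyadicNonsolvableFMWithoutDeRhamRegular` — FALSE in print (generic points
    of the `≥ 3`-dimensional universal deformation space of `ρ̄` are not de Rham, while
    `AutomorphicAE ρ` forces `ρ ≅ ρ_{π,ι}` de Rham), but NO WITNESS is constructible in the tree;
    the regularity half (`Nodup`) alone is load-bearing only for the PROOF (Tung's locally
    algebraic type needs distinct weights): with equal weights the statement is weight-one
    Fontaine–Mazur at `p = 2`, OPEN (Buzzard–Taylor / Pilloni–Stroh need `p > 2`), conjecturally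
    true (odd Artin ⟹ weight one, Khare–Wintenberger Cor. 10.2).
  - a.e. unramified: `aeUnramified_of_automorphicAE` (the conclusion re-implies it, since the
    Satake clause is conjunctive) and `withoutAEUnramified_iff`: dropping it turns the crux into
    "crux ∧ every odd dR-regular residually-non-solvable continuous `ρ` is a.e. unramified" —
    false in nature (infinitely ramified `p`-adic representations: Ramakrishna, Ann. of Math. 151
    (2000); Khare–Larsen–Ramakrishna 2005), no `2`-adic witness in print or in the tree.
* §4 `-- Targets`: the lead's two ACTIVE stubs are the named facts `Tung2020_…_two_tateTwist`
  and `khare_wintenberger 2 ·` (line `Sketch` landed p144785); both vetted ON PAPER against the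
  printed theorems (faithful renderings; details in §4) — 0 broken.
* §5 SMALL MODELS: `isSolvable_GL_two_zmod_two` (`GL₂(𝔽₂) ≅ S₃` is solvable, via its faithful
  action on the four vectors of `𝔽₂²`) and
  `isSolvable_residualRep_range_of_factorsThrough` — a residual representation that factors
  through `GL₂(𝔽₂)` has solvable image, so NO `ρ` whose reduction is definable over `𝔽₂`
  (every elliptic curve over `ℚ`, every newform with `a_p mod 𝔪 ∈ 𝔽₂`) is an instance of this
  crux: the degenerate/smallest cases all belong to `DyadicEisensteinFM` / `DyadicDihedralFM`,
  and the smallest residual image here is `SL₂(𝔽₄) ≅ A₅` (icosahedral mod `2`).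
* Landed on the negative lane: proposal p145157
  (`Theorems/DyadicNonsolvableFM/Negative/ResidualHypothesesRedundant.lean`: §0 + the crux ⟹
  minimal-form theorem).

## For the provers (positive information harvested while attacking)

The honest proof route is a CITE: vendor `Tung2020_fontaineMazurGL2_two` (Math. Z. 2021 Thm. 1,
in the rendering of `Tung2021_fontaineMazurGL2` with `p = 2`, hypothesis
`¬ IsSolvable ρ.residualRep.range` in place of the `ℚ(ζ_p)` clause, and conclusion "newform up to
twist"), then the newform → `IsAutomorphicAE` dictionary shared with `OddPrimesRegularFM`.  By §2
the vendored fact needs neither `IsResiduallyAbsIrreducible` nor `IsIrreducible` as hypotheses.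
-/

set_option linter.dupNamespace false -- project-wide option; `Summit.Langlands.Langlands` is the mandated namespace

noncomputable section

open scoped MatrixGroups
open Matrix NumberField IsDedekindDomain Filter
open Literature.NumberTheory.GaloisRepresentations Literature.NumberTheory.Automorphic
open Summit.Langlands Summit.Langlands.Langlands.Theses.DyadicOddResidue

namespace Summit.Langlands.Langlands.Cruxes.DyadicNonsolvableFM.Disproof

/-! ## §0 Generic lemmas: non-solvable image ⟹ absolutely irreducible (rank 2) -/

section Generic

variable {G : Type*} [Group G] {k : Type*} [Field k]

/-- A two-dimensional representation which is not irreducible has a common eigenvector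
(a non-zero vector spanning a `G`-stable line). [folklore] -/
theorem hasCommonEigenvector_of_not_isIrreducible (σ : G →* GL (Fin 2) k)
    (h : ¬ (toStdRepresentation σ).IsIrreducible) : HasCommonEigenvector σ := by
  classical
  have hbt : (⊥ : Subrepresentation (toStdRepresentation σ)) ≠ ⊤ := by
    intro hbt
    have hmem :
        (Pi.single 0 1 : Fin 2 → k) ∈ (⊤ : Subrepresentation (toStdRepresentation σ)) := by
      change (Pi.single 0 1 : Fin 2 → k) ∈ (⊤ : Submodule k (Fin 2 → k))
      exact Submodule.mem_top
    rw [← hbt] at hmem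
    change (Pi.single 0 1 : Fin 2 → k) ∈ (⊥ : Submodule k (Fin 2 → k)) at hmem
    have h0 : (Pi.single (0 : Fin 2) (1 : k) : Fin 2 → k) = 0 := by
      rwa [Submodule.mem_bot] at hmem
    simpa using congr_fun h0 0
  obtain ⟨W, hWb, hWt⟩ :
      ∃ W : Subrepresentation (toStdRepresentation σ), W ≠ ⊥ ∧ W ≠ ⊤ := by
    by_contra hall
    push Not at hall
    haveI : Nontrivial (Subrepresentation (toStdRepresentation σ)) := ⟨⟨⊥, ⊤, hbt⟩⟩
    exact h ⟨fun W => or_iff_not_imp_left.mpr (hall W)⟩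
  have hWb' : W.toSubmodule ≠ ⊥ := fun h' =>
    hWb (Subrepresentation.toSubmodule_injective (h'.trans rfl))
  have hWt' : W.toSubmodule ≠ ⊤ := fun h' =>
    hWt (Subrepresentation.toSubmodule_injective (h'.trans rfl))
  obtain ⟨v, hvW, hv0⟩ := (Submodule.ne_bot_iff _).mp hWb'
  have hdimW : Module.finrank k W.toSubmodule = 1 := by
    have hlt : Module.finrank k W.toSubmodule < 2 :=
      (Submodule.finrank_lt hWt').trans_eq (Module.finrank_fin_fun k)
    have hpos : 0 < Module.finrank k W.toSubmodule := by
      rw [pos_iff_ne_zero, Ne, Submodule.finrank_eq_zero]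
      exact hWb'
    omega
  have hspan : (k ∙ v) = W.toSubmodule :=
    Submodule.eq_of_le_of_finrank_eq ((Submodule.span_singleton_le_iff_mem v _).mpr hvW)
      (by rw [finrank_span_singleton hv0, hdimW])
  refine ⟨v, hv0, fun g => ?_⟩
  have hmem : ((σ g : GL (Fin 2) k) : Matrix (Fin 2) (Fin 2) k) *ᵥ v ∈ (k ∙ v) := by
    rw [hspan]
    exact W.apply_mem_toSubmodule g hvW
  obtain ⟨a, ha⟩ := Submodule.mem_span_singleton.mp hmem
  exact ⟨a, ha.symm⟩

/-- Membership in the stabiliser of the first coordinate line: the `(1,0)` entry vanishes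
(upper-triangular matrices). [folklore] -/
theorem mem_eigenvectorStabilizer_single_iff (M : GL (Fin 2) k) :
    M ∈ eigenvectorStabilizer (Pi.single 0 1 : Fin 2 → k) (by simp) ↔
      (M : Matrix (Fin 2) (Fin 2) k) 1 0 = 0 := by
  rw [mem_eigenvectorStabilizer_iff]
  constructor
  · rintro ⟨a, ha⟩
    have h1 := congr_fun ha 1
    rw [Matrix.mulVec_single_one] at h1
    simpa using h1
  · intro h10
    refine ⟨(M : Matrix (Fin 2) (Fin 2) k) 0 0, ?_⟩
    rw [Matrix.mulVec_single_one]
    ext i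
    fin_cases i <;> simp [h10]

/-- **The Borel subgroup of `GL₂(k)` is solvable**: the stabiliser of the first coordinate line
(upper-triangular matrices) is an extension of the abelian group `kˣ × kˣ` (diagonal entries) by
the abelian group of unipotent upper-triangular matrices. [folklore] -/
theorem isSolvable_eigenvectorStabilizer_single :
    IsSolvable (eigenvectorStabilizer (Pi.single 0 1 : Fin 2 → k) (by simp)) := by
  set B := eigenvectorStabilizer (Pi.single 0 1 : Fin 2 → k) (by simp) with hB
  have h10 : ∀ M : B, ((M : GL (Fin 2) k) : Matrix (Fin 2) (Fin 2) k) 1 0 = 0 := fun M =>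
    (mem_eigenvectorStabilizer_single_iff (M : GL (Fin 2) k)).mp M.2
  have hdiag : ∀ M : B,
      ((M : GL (Fin 2) k) : Matrix (Fin 2) (Fin 2) k) 0 0 ≠ 0 ∧
        ((M : GL (Fin 2) k) : Matrix (Fin 2) (Fin 2) k) 1 1 ≠ 0 := by
    intro M
    have hdet := GL2.det_ne_zero (M : GL (Fin 2) k)
    rw [Matrix.det_fin_two, h10 M, mul_zero, sub_zero] at hdet
    exact ⟨left_ne_zero_of_mul hdet, right_ne_zero_of_mul hdet⟩
  -- the diagonal character `B → kˣ × kˣ`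
  let χ : B →* kˣ × kˣ := MonoidHom.mk'
    (fun M => (Units.mk0 _ (hdiag M).1, Units.mk0 _ (hdiag M).2))
    (by
      intro M N
      ext
      · simp [Matrix.mul_apply, Fin.sum_univ_two, h10 N]
      · simp [Matrix.mul_apply, Fin.sum_univ_two, h10 M])
  have hχ1 : ∀ M : B, ((χ M).1 : k) = ((M : GL (Fin 2) k) : Matrix (Fin 2) (Fin 2) k) 0 0 :=
    fun M => rfl
  have hχ2 : ∀ M : B, ((χ M).2 : k) = ((M : GL (Fin 2) k) : Matrix (Fin 2) (Fin 2) k) 1 1 :=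
    fun M => rfl
  -- its kernel (unipotent upper-triangular matrices) is commutative
  haveI : IsSolvable χ.ker := by
    refine isSolvable_of_comm fun a b => ?_
    obtain ⟨a, hak⟩ := a
    obtain ⟨b, hbk⟩ := b
    rw [MonoidHom.mem_ker, Prod.ext_iff] at hak hbk
    have ha0 : ((a : GL (Fin 2) k) : Matrix (Fin 2) (Fin 2) k) 0 0 = 1 := by
      rw [← hχ1, hak.1]; rfl
    have ha1 : ((a : GL (Fin 2) k) : Matrix (Fin 2) (Fin 2) k) 1 1 = 1 := by
      rw [← hχ2, hak.2]; rfl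
    have hb0 : ((b : GL (Fin 2) k) : Matrix (Fin 2) (Fin 2) k) 0 0 = 1 := by
      rw [← hχ1, hbk.1]; rfl
    have hb1 : ((b : GL (Fin 2) k) : Matrix (Fin 2) (Fin 2) k) 1 1 = 1 := by
      rw [← hχ2, hbk.2]; rfl
    have ha10 := h10 a
    have hb10 := h10 b
    refine Subtype.ext (Subtype.ext (Units.ext ?_))
    change ((a : GL (Fin 2) k) : Matrix (Fin 2) (Fin 2) k) *
        ((b : GL (Fin 2) k) : Matrix (Fin 2) (Fin 2) k) =
      ((b : GL (Fin 2) k) : Matrix (Fin 2) (Fin 2) k) *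
        ((a : GL (Fin 2) k) : Matrix (Fin 2) (Fin 2) k)
    ext i j
    fin_cases i <;> fin_cases j <;>
      simp [Matrix.mul_apply, Fin.sum_univ_two, ha0, ha1, hb0, hb1, ha10, hb10, add_comm]
  exact solvable_of_ker_le_range χ.ker.subtype χ (by rw [Subgroup.range_subtype])

/-- **The stabiliser in `GL₂(k)` of any line is solvable**: it is conjugate to the Borel
subgroup (complete the vector to an invertible matrix). [folklore] -/
theorem isSolvable_eigenvectorStabilizer (v : Fin 2 → k) (hv : v ≠ 0) :
    IsSolvable (eigenvectorStabilizer v hv) := by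
  classical
  obtain ⟨w, hdet⟩ : ∃ w : Fin 2 → k, v 0 * w 1 - w 0 * v 1 ≠ 0 := by
    by_cases h0 : v 0 = 0
    · refine ⟨![1, 0], ?_⟩
      have h1 : v 1 ≠ 0 := by
        intro h1
        apply hv
        ext i
        fin_cases i <;> simp [h0, h1]
      simpa [h0] using h1
    · exact ⟨![0, 1], by simpa using h0⟩
  let Pm : Matrix (Fin 2) (Fin 2) k := !![v 0, w 0; v 1, w 1]
  have hPdet : Pm.det ≠ 0 := by
    rw [Matrix.det_fin_two_of]
    exact hdet
  let P : GL (Fin 2) k := Matrix.GeneralLinearGroup.mkOfDetNeZero Pm hPdet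
  have hPv : (P : Matrix (Fin 2) (Fin 2) k) *ᵥ Pi.single 0 1 = v := by
    rw [Matrix.mulVec_single_one]
    ext i
    fin_cases i <;> rfl
  have key : ∀ h ∈ eigenvectorStabilizer v hv,
      P⁻¹ * h * P ∈ eigenvectorStabilizer (Pi.single 0 1 : Fin 2 → k) (by simp) := by
    intro h hh
    obtain ⟨a, ha⟩ := hh
    refine ⟨a, ?_⟩
    rw [Matrix.GeneralLinearGroup.coe_mul, Matrix.GeneralLinearGroup.coe_mul,
      ← Matrix.mulVec_mulVec, ← Matrix.mulVec_mulVec, hPv, ha, Matrix.mulVec_smul, ← hPv,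
      Matrix.mulVec_mulVec, ← Matrix.GeneralLinearGroup.coe_mul, inv_mul_cancel,
      Matrix.GeneralLinearGroup.coe_one, Matrix.one_mulVec]
  let φ : eigenvectorStabilizer v hv →*
      eigenvectorStabilizer (Pi.single 0 1 : Fin 2 → k) (by simp) :=
    { toFun := fun h => ⟨P⁻¹ * h * P, key h h.2⟩
      map_one' := Subtype.ext (by simp)
      map_mul' := fun a b => Subtype.ext (by
        simp only [Subgroup.coe_mul]
        group) }
  have hφ : Function.Injective φ := by
    intro a b hab
    have h' : P⁻¹ * (a : GL (Fin 2) k) * P = P⁻¹ * (b : GL (Fin 2) k) * P :=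
      congrArg Subtype.val hab
    exact Subtype.ext (mul_left_cancel (mul_right_cancel h'))
  haveI := isSolvable_eigenvectorStabilizer_single (k := k)
  exact solvable_of_solvable_injective hφ

/-- **A two-dimensional representation which is not irreducible has solvable image**: the image
stabilises a line, and the stabiliser of a line in `GL₂` is solvable. [folklore] -/
theorem isSolvable_range_of_not_isIrreducible (σ : G →* GL (Fin 2) k)
    (h : ¬ (toStdRepresentation σ).IsIrreducible) : IsSolvable σ.range := by
  obtain ⟨v, hv, key⟩ := hasCommonEigenvector_of_not_isIrreducible σ h
  have hle : σ.range ≤ eigenvectorStabilizer v hv := by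
    rintro _ ⟨g, rfl⟩
    exact key g
  haveI := isSolvable_eigenvectorStabilizer v hv
  exact solvable_of_solvable_injective (Subgroup.inclusion_injective hle)

/-- `GL₂(f)` is injective for a field homomorphism `f`. [folklore] -/
theorem generalLinearGroup_map_injective {k' : Type*} [Field k'] (f : k →+* k') :
    Function.Injective (Matrix.GeneralLinearGroup.map (n := Fin 2) f) := by
  intro a b hab
  ext i j
  apply f.injective
  have := congrArg (fun M : GL (Fin 2) k' => (M : Matrix (Fin 2) (Fin 2) k') i j) hab
  simpa [Matrix.GeneralLinearGroup.map_apply] using this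

/-- **Non-solvable image forces absolute irreducibility** (rank `2`, any field, any
characteristic): after any extension of scalars `f : k → k'` the image is isomorphic to the
original one (`GL₂(f)` is injective), and a reducible two-dimensional representation has
solvable image (`isSolvable_range_of_not_isIrreducible`). [folklore] -/
theorem isAbsIrreducible_of_not_isSolvable_range (σ : G →* GL (Fin 2) k)
    (h : ¬ IsSolvable σ.range) : IsAbsIrreducible σ := by
  intro k' _ f
  by_contra hirr
  apply h
  have hs : IsSolvable ((Matrix.GeneralLinearGroup.map f).comp σ).range :=
    isSolvable_range_of_not_isIrreducible _ hirr
  rw [MonoidHom.range_comp] at hs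
  exact solvable_of_solvable_injective
    (f := (σ.range.equivMapOfInjective _ (generalLinearGroup_map_injective f)).toMonoidHom)
    (σ.range.equivMapOfInjective _ (generalLinearGroup_map_injective f)).injective

/-- Solvability of the image passes along `ker τ₀ ≤ ker τ` (the image of `τ` is a quotient of the
image of `τ₀`). [folklore] -/
theorem isSolvable_range_of_ker_le {N N' : Type*} [Group N] [Group N'] {τ₀ : G →* N}
    {τ : G →* N'} (hker : τ₀.ker ≤ τ.ker) (h : IsSolvable τ₀.range) : IsSolvable τ.range := by
  haveI : IsSolvable (G ⧸ τ₀.ker) :=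
    solvable_of_surjective (f := (QuotientGroup.quotientKerEquivRange τ₀).symm.toMonoidHom)
      (MulEquiv.surjective _)
  have hle : τ₀.ker ≤ τ.ker.comap (MonoidHom.id G) := by simpa using hker
  haveI : IsSolvable (G ⧸ τ.ker) := by
    refine solvable_of_surjective (f := QuotientGroup.map τ₀.ker τ.ker (MonoidHom.id G) hle) ?_
    exact QuotientGroup.map_surjective_of_surjective τ₀.ker τ.ker (MonoidHom.id G)
      (fun x => by
        obtain ⟨g, rfl⟩ := QuotientGroup.mk_surjective x
        exact ⟨g, rfl⟩) hle
  exact solvable_of_surjective (f := (QuotientGroup.quotientKerEquivRange τ).toMonoidHom)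
    (MulEquiv.surjective _)

/-- **Hypothesis `hres` of the crux follows from hypothesis `hsol`**: for
`ρ : Γ_K → GL₂(ℚ̄_ℓ)`, if the image of the (semisimplified) residual representation
`ρ.residualRep` is not solvable then `ρ` is residually absolutely irreducible.  (The junk branch
of `residualRep` has trivial, hence solvable, image; otherwise `residualRep` is a
semisimplification of a reduction `τ₀`, `ker τ₀ ≤ ker residualRep`, so `τ₀` has non-solvable
image and is absolutely irreducible by `isAbsIrreducible_of_not_isSolvable_range`.) [folklore] -/
theorem isResiduallyAbsIrreducible_of_not_isSolvable_residualRep_range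
    {K : Type*} [Field K] {ℓ : ℕ} [Fact ℓ.Prime] (ρ : FramedGaloisRep K (PadicAlgCl ℓ) 2)
    (h : ¬ IsSolvable ρ.residualRep.range) : ρ.IsResiduallyAbsIrreducible := by
  classical
  have hex : ∃ τ, ρ.IsResidualRepOf (RingHom.id _) τ := by
    by_contra hne
    apply h
    rw [FramedGaloisRep.residualRep, dif_neg hne, MonoidHom.range_one]
    infer_instance
  obtain ⟨τ₀, hred, hss⟩ := FramedGaloisRep.residualRep_spec ρ hex
  refine ⟨τ₀, hred, isAbsIrreducible_of_not_isSolvable_range τ₀ fun hsol => h ?_⟩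
  exact isSolvable_range_of_ker_le hss.2.2 hsol

/-- **Hypothesis `hirr` of the crux follows from hypothesis `hres`**: a residually absolutely
irreducible `ρ : Γ_K → GL₂(ℚ̄_ℓ)` is irreducible (in-tree: Burnside form of residual absolute
irreducibility, `IsResiduallyAbsIrreducible.isAbsolutelyIrreducible`, Darmon–Diamond–Taylor §2.1).
[folklore] -/
theorem isIrreducible_of_isResiduallyAbsIrreducible
    {K : Type*} [Field K] {ℓ : ℕ} [Fact ℓ.Prime] (ρ : FramedGaloisRep K (PadicAlgCl ℓ) 2)
    (h : ρ.IsResiduallyAbsIrreducible) : ρ.toGaloisRep.IsIrreducible :=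
  (FramedGaloisRep.IsResiduallyAbsIrreducible.isAbsolutelyIrreducible two_pos h).isIrreducible

/-- … hence **`hsol` alone implies both `hres` and `hirr`**. [folklore] -/
theorem isIrreducible_of_not_isSolvable_residualRep_range
    {K : Type*} [Field K] {ℓ : ℕ} [Fact ℓ.Prime] (ρ : FramedGaloisRep K (PadicAlgCl ℓ) 2)
    (h : ¬ IsSolvable ρ.residualRep.range) : ρ.toGaloisRep.IsIrreducible :=
  isIrreducible_of_isResiduallyAbsIrreducible ρ
    (isResiduallyAbsIrreducible_of_not_isSolvable_residualRep_range ρ h)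


end Generic

/-! ## §1 The crux at the literal prime `2`; clause abbreviations -/

/-- Clause "unramified at all but finitely many places" of the crux (at `ℓ = 2`). -/
def AEUnramified (ρ : FramedGaloisRep ℚ (PadicAlgCl 2) 2) : Prop :=
  ∀ᶠ v : HeightOneSpectrum (𝓞 ℚ) in cofinite, ρ.IsUnramifiedAt v

/-- Clause "de Rham at `2` for Fontaine's pinned datum, with multiplicity-free labelled
Hodge–Tate weights" of the crux (at `ℓ = 2`). -/
def DeRhamRegularAtTwo (ρ : FramedGaloisRep ℚ (PadicAlgCl 2) 2) : Prop :=
  ∀ (v : HeightOneSpectrum (𝓞 ℚ)) (hv : ((2 : ℕ) : 𝓞 ℚ) ∈ v.asIdeal),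
    (Literature.NumberTheory.PAdicHodge.fontainePstAdicCompletion v 2 hv).IsDeRhamFramed
        (ρ.toLocal v) ∧
      ∀ τ : v.adicCompletion ℚ →+* PadicAlgCl 2, Continuous τ →
        (ρ.labelledHodgeTateWeightsAt v
          (Literature.NumberTheory.PAdicHodge.fontainePstAdicCompletion v 2 hv).algebra
          (Literature.NumberTheory.PAdicHodge.fontainePstAdicCompletion v 2 hv).𝔅 τ).Nodup

/-- The conclusion of the crux (at `ℓ = 2`): for every level witness `hcpt` and every
`ι : ℚ̄₂ ≃ ℂ`, `ρ` is Satake–Frobenius compatible a.e. with an L-algebraic cuspidal `π` of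
`GL₂(𝔸_ℚ)` — definitionally `∀ hcpt ι, IsAutomorphicAE ι hcpt ρ` (`automorphicAE_iff`). -/
def AutomorphicAE (ρ : FramedGaloisRep ℚ (PadicAlgCl 2) 2) : Prop :=
  ∀ (hcpt : isCompact_glFiniteIntegralLevel 2 ℚ) (ι : PadicAlgCl 2 ≃+* ℂ),
    ∃ π : CuspidalAutomorphicRepData 2 ℚ hcpt, π.1.IsLAlgebraic ∧
      ∀ᶠ v : HeightOneSpectrum (𝓞 ℚ) in cofinite, SatakeFrobCompatibleAt ι π.1 ρ v

/-- The conclusion is the accepted automorphy clause `IsAutomorphicAE` (definitional). -/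
theorem automorphicAE_iff (ρ : FramedGaloisRep ℚ (PadicAlgCl 2) 2) :
    AutomorphicAE ρ ↔
      ∀ (hcpt : isCompact_glFiniteIntegralLevel 2 ℚ) (ι : PadicAlgCl 2 ≃+* ℂ),
        IsAutomorphicAE ι hcpt ρ :=
  Iff.rfl

/-- **The crux at the literal prime `2`** (the binder `∀ ℓ [Fact ℓ.Prime], ℓ = 2 →` of the route
file is cosmetic: `dyadicNonsolvableFM_iff_atTwo`). -/
def DyadicNonsolvableFMAtTwo : Prop :=
  ∀ ρ : FramedGaloisRep ℚ (PadicAlgCl 2) 2, ρ.IsResiduallyAbsIrreducible →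
    ¬ IsSolvable ρ.residualRep.range → ρ.toGaloisRep.IsIrreducible → ρ.IsOdd →
      AEUnramified ρ → DeRhamRegularAtTwo ρ → AutomorphicAE ρ

/-- The route decl `DyadicNonsolvableFM` is equivalent to its `ℓ := 2` instance. -/
theorem dyadicNonsolvableFM_iff_atTwo : DyadicNonsolvableFM ↔ DyadicNonsolvableFMAtTwo := by
  constructor
  · intro h ρ hres hsol hirr hodd hunr hdR hcpt ι
    exact h 2 rfl ρ hres hsol hirr hodd hunr hdR hcpt ι
  · intro h ℓ _ hℓ ρ hres hsol hirr hodd hunr hdR hcpt ι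
    subst hℓ
    exact h ρ hres hsol hirr hodd hunr hdR hcpt ι


/-! ## §2 Hypothesis mutation (PROVED): `hres` and `hirr` are decoration -/

/-- **Minimal form of the crux**: the five genuinely independent hypotheses — non-solvable
residual image, odd, unramified a.e., de Rham at `2` with distinct labelled Hodge–Tate weights.
Equivalent to `DyadicNonsolvableFM` (`dyadicNonsolvableFM_iff_minimal`). -/
def DyadicNonsolvableFMMinimal : Prop :=
  ∀ ρ : FramedGaloisRep ℚ (PadicAlgCl 2) 2, ¬ IsSolvable ρ.residualRep.range → ρ.IsOdd →
    AEUnramified ρ → DeRhamRegularAtTwo ρ → AutomorphicAE ρ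

/-- **`DyadicNonsolvableFM ↔ DyadicNonsolvableFMMinimal`**: the hypotheses
`ρ.IsResiduallyAbsIrreducible` (`hres`) and `ρ.toGaloisRep.IsIrreducible` (`hirr`) of the crux are
implied by `¬ IsSolvable ρ.residualRep.range` (`hsol`)
(`isResiduallyAbsIrreducible_of_not_isSolvable_residualRep_range`,
`isIrreducible_of_not_isSolvable_residualRep_range`).  Mutation finding: "`hres`, `hirr`
unnecessary" — kernel-checked. -/
theorem dyadicNonsolvableFM_iff_minimal : DyadicNonsolvableFM ↔ DyadicNonsolvableFMMinimal := by
  rw [dyadicNonsolvableFM_iff_atTwo]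
  constructor
  · intro h ρ hsol hodd hunr hdR
    exact h ρ (isResiduallyAbsIrreducible_of_not_isSolvable_residualRep_range ρ hsol) hsol
      (isIrreducible_of_not_isSolvable_residualRep_range ρ hsol) hodd hunr hdR
  · intro h ρ _ hsol _ hodd hunr hdR
    exact h ρ hsol hodd hunr hdR

/-! ## §3 Load-bearing analysis of the remaining hypotheses -/

/-- **The crux WITHOUT the residual hypotheses** (`hres`, `hsol` dropped): Fontaine–Mazur at
`ℓ = 2` for ALL irreducible odd geometric `ρ` with distinct Hodge–Tate weights.  Status: OPEN
(= the route's target sector at `2`); `withoutNonsolvable_iff` identifies it with the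
conjunction of the route's three dyadic statements. -/
def DyadicNonsolvableFMWithoutNonsolvable : Prop :=
  ∀ ρ : FramedGaloisRep ℚ (PadicAlgCl 2) 2, ρ.toGaloisRep.IsIrreducible → ρ.IsOdd →
    AEUnramified ρ → DeRhamRegularAtTwo ρ → AutomorphicAE ρ

/-- **Dropping `hsol` = the two OPEN cruxes**: the crux without its residual hypotheses is
equivalent to `DyadicEisensteinFM ∧ DyadicDihedralFM ∧ DyadicNonsolvableFM` (the trichotomy
"`ρ̄` not abs. irreducible / abs. irreducible solvable / non-solvable" of the route's `closes`).
Hence `hsol` is load-bearing exactly modulo the open statements K1, K2, and no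
`_false_without_hsol` theorem can exist unless Fontaine–Mazur fails at `2`. -/
theorem withoutNonsolvable_iff :
    DyadicNonsolvableFMWithoutNonsolvable ↔
      (DyadicEisensteinFM ∧ DyadicDihedralFM ∧ DyadicNonsolvableFM) := by
  constructor
  · intro h
    refine ⟨?_, ?_, ?_⟩
    · intro ℓ _ hℓ ρ _ hirr hodd hunr hdR hcpt ι
      subst hℓ
      exact h ρ hirr hodd hunr hdR hcpt ι
    · intro ℓ _ hℓ ρ _ _ hirr hodd hunr hdR hcpt ι
      subst hℓ
      exact h ρ hirr hodd hunr hdR hcpt ι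
    · intro ℓ _ hℓ ρ _ _ hirr hodd hunr hdR hcpt ι
      subst hℓ
      exact h ρ hirr hodd hunr hdR hcpt ι
  · rintro ⟨h₁, h₂, h₄⟩ ρ hirr hodd hunr hdR hcpt ι
    by_cases hres : ρ.IsResiduallyAbsIrreducible
    · by_cases hsol : IsSolvable ρ.residualRep.range
      · exact h₂ 2 rfl ρ hres hsol hirr hodd hunr hdR hcpt ι
      · exact h₄ 2 rfl ρ hres hsol hirr hodd hunr hdR hcpt ι
    · exact h₁ 2 rfl ρ hres hirr hodd hunr hdR hcpt ι

/-- **The crux WITHOUT oddness.**  Status: OPEN, conjecturally TRUE for want of instances (an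
even irreducible geometric `ρ` with distinct HT weights would, by Fontaine–Mazur + Langlands,
come from a REGULAR L-algebraic cuspidal `π` of `GL₂(𝔸_ℚ)`, whose `π_∞` is a discrete series, so
`ρ` would be odd; unconditionally Calegari, Invent. Math. 185 (2011) / JAMS 25 (2012) exclude
even such `ρ` only for `p > 7`).  Not refutable here or in print.  Oddness IS used by Tung's
proof (the fixed central character `ψ = ε⁻¹ det ρ` of the definite quaternionic forms must be an
automorphic character; Thm. 8.0.4 prints only "`ρ̄` totally odd", vacuous mod `2`, but "`ρ` as in
the conjecture" in Thm. 1 includes "`ρ` is odd"). -/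
def DyadicNonsolvableFMWithoutOdd : Prop :=
  ∀ ρ : FramedGaloisRep ℚ (PadicAlgCl 2) 2, ¬ IsSolvable ρ.residualRep.range →
    AEUnramified ρ → DeRhamRegularAtTwo ρ → AutomorphicAE ρ

/-- Dropping oddness only strengthens: `WithoutOdd → Minimal` (trivial direction; the converse
is the open non-existence of even regular geometric `ρ` at `ℓ = 2`). -/
theorem minimal_of_withoutOdd (h : DyadicNonsolvableFMWithoutOdd) : DyadicNonsolvableFMMinimal :=
  fun ρ hsol _ hunr hdR => h ρ hsol hunr hdR

/-- **The crux WITHOUT "de Rham at `2` with distinct HT weights".**  Status: FALSE in print but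
no witness constructible in the tree.  (i) Without de Rham: `AutomorphicAE ρ` forces
`ρ ≅ ρ_{π,ι}` (Chebotarev + Brauer–Nesbitt; `π` regular L-algebraic cuspidal on `GL₂/ℚ` ⟹ `ρ_π`
de Rham, Faltings/Saito), while Zariski-generic `ℚ̄₂`-points of the universal deformation ring
of an odd non-solvable `ρ̄` (Krull dimension `≥ 3` over `ℤ₂`, Mazur) are not de Rham of any
fixed type — such a point is a counterexample, but the tree has no Galois representation of
`Γ_ℚ` with non-solvable mod-`2` image at all.  (ii) Keeping de Rham and dropping only `Nodup`
(equal weights): weight-one Fontaine–Mazur at `p = 2` — OPEN (Buzzard–Taylor 1999 and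
Pilloni–Stroh 2016 assume `p > 2`), conjecturally TRUE (such `ρ` are Artin up to twist; odd
Artin ⟹ weight one by Khare–Wintenberger Cor. 10.2): `Nodup` is load-bearing for Tung's PROOF
(locally algebraic type of distinct weights), not for truth. -/
def DyadicNonsolvableFMWithoutDeRhamRegular : Prop :=
  ∀ ρ : FramedGaloisRep ℚ (PadicAlgCl 2) 2, ¬ IsSolvable ρ.residualRep.range → ρ.IsOdd →
    AEUnramified ρ → AutomorphicAE ρ

/-- Dropping the `2`-adic Hodge clause only strengthens (trivial direction). -/
theorem minimal_of_withoutDeRhamRegular (h : DyadicNonsolvableFMWithoutDeRhamRegular) :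
    DyadicNonsolvableFMMinimal :=
  fun ρ hsol hodd hunr _ => h ρ hsol hodd hunr

/-- **The crux WITHOUT "unramified almost everywhere".**  See `withoutAEUnramified_iff`. -/
def DyadicNonsolvableFMWithoutAEUnramified : Prop :=
  ∀ ρ : FramedGaloisRep ℚ (PadicAlgCl 2) 2, ¬ IsSolvable ρ.residualRep.range → ρ.IsOdd →
    DeRhamRegularAtTwo ρ → AutomorphicAE ρ

/-- **The conclusion re-implies "unramified a.e."**: the Satake clause `SatakeFrobCompatibleAt`
is conjunctive (`ρ.IsUnramifiedAt v` at cofinitely many `v`), so an automorphic `ρ` is a.e.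
unramified — given one level witness `hcpt` and one `ι : ℚ̄₂ ≃+* ℂ` to instantiate the
conclusion. -/
theorem aeUnramified_of_automorphicAE (ρ : FramedGaloisRep ℚ (PadicAlgCl 2) 2)
    (hcpt : isCompact_glFiniteIntegralLevel 2 ℚ) (ι : PadicAlgCl 2 ≃+* ℂ)
    (h : AutomorphicAE ρ) : AEUnramified ρ := by
  obtain ⟨π, -, hπ⟩ := h hcpt ι
  exact hπ.mono fun v ⟨_, _, hρ, _⟩ => hρ

/-- **Dropping "unramified a.e." = crux ∧ an unramifiedness assertion**: given a level witness
and an `ι`, the crux without `hunr` is equivalent to the minimal crux together with "every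
continuous odd, de Rham-regular-at-`2`, residually non-solvable `ρ : Γ_ℚ → GL₂(ℚ̄₂)` is
unramified at all but finitely many places" — false in nature (infinitely ramified `p`-adic
representations with prescribed local behaviour: Ramakrishna, Ann. of Math. 151 (2000);
Khare–Larsen–Ramakrishna, Amer. J. Math. 127 (2005)), though no `2`-adic residually-`A₅` witness
is in print or constructible here.  So `hunr` is load-bearing. -/
theorem withoutAEUnramified_iff (hcpt : isCompact_glFiniteIntegralLevel 2 ℚ)
    (ι : PadicAlgCl 2 ≃+* ℂ) :
    DyadicNonsolvableFMWithoutAEUnramified ↔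
      (DyadicNonsolvableFMMinimal ∧
        ∀ ρ : FramedGaloisRep ℚ (PadicAlgCl 2) 2, ¬ IsSolvable ρ.residualRep.range → ρ.IsOdd →
          DeRhamRegularAtTwo ρ → AEUnramified ρ) := by
  constructor
  · intro h
    exact ⟨fun ρ hsol hodd _ hdR => h ρ hsol hodd hdR,
      fun ρ hsol hodd hdR => aeUnramified_of_automorphicAE ρ hcpt ι (h ρ hsol hodd hdR)⟩
  · rintro ⟨h, hunr⟩ ρ hsol hodd hdR
    exact h ρ hsol hodd (hunr ρ hsol hodd hdR) hdR

/-! ## §4 Targets (the lead's stubs)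

Payload `stuck_stubs = []`.  State of the crux at 2026-08-17T06:40Z (item record): line `Sketch`
(idea `serre-avatar-modus-ponens`) LANDED as p144785,
`Summit.Langlands.Langlands.Theorems.dyadicNonsolvableFM_of_Tung2020 :
Tung2020_fontaineMazurGL2_two_tateTwist → (∀ k, khare_wintenberger 2 k) → DyadicNonsolvableFM`;
the two ACTIVE stubs are the named facts themselves.  Paper vetting of both (no Lean kill is
possible — each is a printed theorem; a `_false` theorem would need a non-modular `ρ`):

* `stub_Tung2020_fontaineMazurGL2_two_tateTwist` (`Literature/NumberTheory/Automorphic/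
  FontaineMazurGL2DyadicNonsolvable`): hypotheses VERBATIM `XZhang2024_fontaineMazurGL2_tateTwist`
  at `2` + (NS) `¬ IsSolvable ρ.residualRep.range` + (RM) Serre-shaped residual modularity of a
  model `τ = GL₂(ι) ∘ ρ̄` over an algebraically closed discrete `k` of characteristic `2`;
  conclusion `∃ m, ρ ⊗ ε₂^m` attached to a newform away from `2N`.  Checked against Tung Thm. 1 /
  Thm. 8.0.4 (pp. 4, 32 of arXiv:1908.06174): faithful; (RM) in char-poly form is STRONGER than
  "`ρ̄ ≅ ρ̄_f` up to twist" (so the fact is weaker than print); the Tate-twist conclusion is the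
  printed "twist by a character" because the twisting character is de Rham and a.e. unramified,
  hence `ε₂^{-m} ·` finite order, and finite-order twists of newforms are newforms; the
  conclusion's unramifiedness of `ρ ⊗ χ` off `2N` holds since `ρ ⊗ χ ≅ ρ_{f,ι_f}`.  By §2 its
  hypothesis `ρ.toGaloisRep.IsIrreducible` is implied by (NS) (harmless extra binder).
* `stub_khare_wintenberger_two` = `∀ k, SerreModularityConjecture 2 k` (strong form: level
  `N(ρ̄)`, weight `k(ρ̄)`, character FREE).  Checked against Khare–Wintenberger (I), Invent. Math.
  178 (2009): p. 2 "In the case of `p = 2`, the values of `k(ρ̄)` can either be 2 or 4, with the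
  former iff `ρ̄` is finite at 2"; Thm. 1.2(2) (`k(ρ̄) = 2`) and Thm. 9.1 ("Assume Hypothesis (H).
  Then Serre's conjecture is true", (H) = Kisin 2009, 2-adic Barsotti–Tate; the proof begins with
  `p = 2`, `k(ρ̄) = 4`).  The tree's `serreWeightLocal` carries the `p = 2` très ramifiée clause
  `m = 4` (Serre §2.4 (ii₂); `serreWeightLocal_le_four`), so the weight is KW's `{2, 4}`; leaving
  the nebentypus free only weakens Serre's (3.2.4) (whose prescribed character is exactly what
  fails at `p = 2, 3` in the dihedral exceptions), so the stub is implied by the printed theorem.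
  S-type = absolutely irreducible odd over a finite field: a continuous `ρ̄` into `GL₂(k)`, `k`
  discrete algebraically closed, has finite image and is conjugate into a finite subfield;
  oddness is automatic in characteristic `2`.  Faithful.

Verdict on targets: 2 vetted, 0 broken, none misstated. -/


/-! ## §5 Small models: residual images inside `GL₂(𝔽₂)` are solvable (degenerate cases excluded) -/

/-- **`GL₂(𝔽₂)` is solvable** (`≅ S₃`): it acts faithfully on the four vectors of `𝔽₂²`, and the
symmetric group on `≤ 4` letters is solvable (in-tree `perm_isSolvable_of_card_le_four`).
[folklore] -/
theorem isSolvable_GL_two_zmod_two : IsSolvable (GL (Fin 2) (ZMod 2)) := by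
  let φ := MulAction.toPermHom (GL (Fin 2) (ZMod 2)) (Fin 2 → ZMod 2)
  have hφ : Function.Injective φ := by
    intro M N hMN
    ext i j
    have h := congrArg (fun σ : Equiv.Perm (Fin 2 → ZMod 2) => σ (Pi.single j 1) i) hMN
    simp only [φ, MulAction.toPermHom_apply, MulAction.toPerm_apply] at h
    change ((M : Matrix (Fin 2) (Fin 2) (ZMod 2)) *ᵥ Pi.single j 1) i =
      ((N : Matrix (Fin 2) (Fin 2) (ZMod 2)) *ᵥ Pi.single j 1) i at h
    simpa [Matrix.mulVec_single_one] using h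
  haveI : IsSolvable (Equiv.Perm (Fin 2 → ZMod 2)) :=
    Literature.NumberTheory.NumberFields.perm_isSolvable_of_card_le_four (by simp)
  exact solvable_of_solvable_injective hφ

/-- **Degenerate case excluded by `hsol`**: if the residual representation of
`ρ : Γ_K → GL₂(ℚ̄₂)` factors through `GL₂(𝔽₂) → GL₂(ℤ̄₂/𝔪)` (its reduction is definable over
the prime field — e.g. the `2`-adic Tate module of ANY elliptic curve over `ℚ`, or `ρ_{f,𝔪}` for a
newform with `a_p mod 𝔪 ∈ 𝔽₂` for all `p`), then the residual image is solvable and `ρ` is not an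
instance of `DyadicNonsolvableFM`.  The smallest residual image admitted by the crux is therefore
`SL₂(𝔽₄) ≅ A₅`; all "small" test objects live in the sibling cruxes. [folklore] -/
theorem isSolvable_residualRep_range_of_factorsThrough {K : Type*} [Field K]
    (ρ : FramedGaloisRep K (PadicAlgCl 2) 2) (f : ZMod 2 →+* padicAlgClResidueField 2)
    (σ₀ : Field.absoluteGaloisGroup K →* GL (Fin 2) (ZMod 2))
    (h : ρ.residualRep = (Matrix.GeneralLinearGroup.map f).comp σ₀) :
    IsSolvable ρ.residualRep.range := by
  rw [h, MonoidHom.range_comp]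
  haveI := isSolvable_GL_two_zmod_two
  exact solvable_of_surjective
    ((Matrix.GeneralLinearGroup.map f).subgroupMap_surjective σ₀.range)

end Summit.Langlands.Langlands.Cruxes.DyadicNonsolvableFM.Disproof

end
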